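import Summits.CriticalPhenomena.PercolationContinuityZ3.Theorems.PercNearOneGluingNoHeavyLowerTailCubicFourPointL1Cells
import Mathlib.Tactic.Ring
import Mathlib.Tactic.Linarith
import HarnessLib

/-!
# `NoHeavyLowerTail` (stmt-CriticalPhenomena-4575) — the polarised E3GRP form (L1): two MOVES proved from Harris
# (the pendant-`b` move and the first Bernstein piece of the `(a,b)`-edge move)

Support file (prover prim-l12-p2, `--supports stmt-CriticalPhenomena-4575`; P2 = deletion–contraction / closure calculus for (L1)).
Pure algebra (`ring` identities found by exact LP / computer algebra in the seat engine, dc/), no sorries, no definitions, no named facts;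
vocabulary of `…CubicFourPointL1Step` (`HybMasses.L1`, `HybMasses.pol`) and `…CubicFourPointL1Cells` (`HybMasses.ofCells`, 13 free cells of
the 15-cell law of `(a,b,c,y)`, total mass `1`).

RESULTS.
* `L1_cells_pendant_b_two_harris` — THE PENDANT-`b` MOVE IS HARRIS.  If the terminal `b` hangs off a vertex `u` (connection probability `r`,
  `λ` = law of `(a,u,c,y)`), then EXACTLY
      `L1 = r(1−r)·[ H(D[a|c], D[b|acy]) + H(D[b|ac], D[c|ay]) ] + r²·L1(λ)`,
  `H(X,Y) = P(X∩Y) − P(X)P(Y)` the Harris form of two decreasing (group-separation) events (`D[b|acy]` = "`b` joined to none of `a,c,y`",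
  `D[c|ay]` = "`c` joined to neither `a` nor `y`").  So the new four-point row `PB` of `…L1Cells` is `PB = H(D[a|c],D[b|acy]) + H(D[b|ac],D[c|ay])`
  — nonnegative on every realizable law by Harris–FKG — and (`L1_cells_pendant_b_nonneg_of_harris`) hanging `b` (or, by the `b ↔ c`
  mirror, `c`) behind a cut vertex PRESERVES (L1) given only Harris and (L1) for `λ`.  With the pendant-`y` move (`L1_cells_pendant_y`, needs
  SHK3⁺ only) and the strata, this proves (L1) on every TREE with arbitrary edge weights by peeling terminal leaves (a leaf among `b,c,y`
  always exists), modulo the three-point theorems SHK3⁺ `F ≥ 0`, Aas–Gladkov and Harris — see the seat memo for the graph-level assembly.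
* `pol_cells_edge_ab` — THE `(a,b)`-EDGE MOVE, first piece.  Contracting an edge between the terminals `a,b` maps the law to `glue_ab(λ)`
  (linear); the first Bernstein piece of (L1) along this edge is EXACTLY
      `pol(λ, glue_ab λ) = 2·L1(λ) + H(D[a|b],D[a|c])·(Σ cells a~c,b apart) + H(D[a|b],D[b|c])·(«ay|bc»+«a|bc|y»)
                         + H(D[b|c],D[ay|b])·(«ay|bc»+«a|bcy»+«a|bc|y») + H(D[ay|b],D[ay|c])·(Σ cells a~c,b apart) + 27 cubic cell monomials`
  (integer certificate), hence `≥ 0` given (L1) for `λ`, Harris and nonnegative cells (`pol_cells_edge_ab_nonneg`).  (The second piece and the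
  `(b,c)`-edge pieces have certificates over the same dictionary — kit j076268/j077240 — to be appended.)
[cite: Gladkov2024StrongFKG, Cor. 4.2 (cubic rows; Harris/AG dictionary)]; [cite: GladkovZimin2024HK, §4 (one-edge decomposition)]
-/

namespace Summit.CriticalPhenomena.PercolationContinuityZ3.Theorems

namespace HybMasses

open CubicThreePointStep

variable {R : Type*} [CommRing R]

/-- **The pendant-`b` move is a consequence of Harris.**  Along the pendant-`b` pencil (total mass `1`),
`L1((1−r)·ι_b(λ) + r·λ) = r(1−r)·[H(D[a|c], D[b|acy]) + H(D[b|ac], D[c|ay])] + r²·L1(λ)`, where `H(X,Y) = P(X∩Y) − P(X)P(Y)` are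
Harris forms of two DECREASING (group-separation) events, written out in the cells. [folklore] -/
theorem L1_cells_pendant_b_two_harris («a|b|c|y» «a|b|cy» «a|by|c» «a|bc|y» «ay|b|c» «ac|b|y» «ab|c|y» «a|bcy» «ay|bc» «ac|by» «acy|b» «ab|cy» «aby|c» «abc|y» «abcy» r : R)
    (hσ : «a|b|c|y» + «a|b|cy» + «a|by|c» + «a|bc|y» + «ay|b|c» + «ac|b|y» + «ab|c|y» + «a|bcy» + «ay|bc» + «ac|by» + «acy|b» + «ab|cy» + «aby|c» + «abc|y» + «abcy» = 1) :
    (ofCells ((1 - r) * («a|b|c|y» + «a|by|c» + «a|bc|y» + «ab|c|y») + r * «a|b|c|y») ((1 - r) * («a|b|cy» + «a|bcy» + «ab|cy») + r * «a|b|cy») (r * «a|by|c») (r * «a|bc|y») ((1 - r) * («ay|b|c» + «ay|bc» + «aby|c») + r * «ay|b|c») ((1 - r) * («ac|b|y» + «ac|by» + «abc|y») + r * «ac|b|y») (r * «ab|c|y») (r * «a|bcy») (r * «ay|bc») (r * «ac|by») ((1 - r) * («acy|b» + «abcy») + r * «acy|b») (r * «ab|cy») (r * «aby|c»)).L1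
      = r * (1 - r) * (((«a|b|c|y» + «a|b|cy» + «ay|b|c») - («a|b|c|y» + «a|b|cy» + «a|by|c» + «a|bc|y» + «ay|b|c» + «ab|c|y» + «a|bcy» + «ay|bc» + «ab|cy» + «aby|c») * («a|b|c|y» + «a|b|cy» + «ay|b|c» + «ac|b|y» + «acy|b»)) + ((«a|b|c|y» + «a|by|c» + «ay|b|c») - («a|b|c|y» + «a|b|cy» + «a|by|c» + «ay|b|c» + «ac|b|y» + «ac|by» + «acy|b») * («a|b|c|y» + «a|by|c» + «a|bc|y» + «ay|b|c» + «ab|c|y» + «ay|bc» + «aby|c»)))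
        + r ^ 2 * (ofCells («a|b|c|y») («a|b|cy») («a|by|c») («a|bc|y») («ay|b|c») («ac|b|y») («ab|c|y») («a|bcy») («ay|bc») («ac|by») («acy|b») («ab|cy») («aby|c»)).L1 := by
  have h : «abcy» = 1 - («a|b|c|y» + «a|b|cy» + «a|by|c» + «a|bc|y» + «ay|b|c» + «ac|b|y» + «ab|c|y» + «a|bcy» + «ay|bc» + «ac|by» + «acy|b» + «ab|cy» + «aby|c» + «abc|y») := by rw [← hσ]; ring
  subst h
  simp only [ofCells, L1, E3h]; ring

/-- **The `(a,b)`-edge move, first Bernstein piece.**  With `x⁰ = λ` and `x¹ = glue_ab(λ)` (the law after contracting an edge between the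
terminals `a` and `b`; total mass `1`):  `pol x⁰ x¹ = 2·L1(λ) + [four Harris forms × nonnegative cell sums] + [27 cubic cell monomials]`
— an exact certificate (found by LP, integer coefficients), so `pol x⁰ x¹ ≥ 0` follows from (L1) for `λ`, Harris and `cells ≥ 0`. [folklore] -/
theorem pol_cells_edge_ab («a|b|c|y» «a|b|cy» «a|by|c» «a|bc|y» «ay|b|c» «ac|b|y» «ab|c|y» «a|bcy» «ay|bc» «ac|by» «acy|b» «ab|cy» «aby|c» : R) :
    pol (ofCells («a|b|c|y») («a|b|cy») («a|by|c») («a|bc|y») («ay|b|c») («ac|b|y») («ab|c|y») («a|bcy») («ay|bc») («ac|by») («acy|b») («ab|cy») («aby|c»)) (ofCells 0 0 0 0 0 0 («a|b|c|y» + «ab|c|y») 0 0 0 0 («a|b|cy» + «ab|cy») («a|by|c» + «ay|b|c» + «aby|c»))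
      = 2 * (ofCells («a|b|c|y») («a|b|cy») («a|by|c») («a|bc|y») («ay|b|c») («ac|b|y») («ab|c|y») («a|bcy») («ay|bc») («ac|by») («acy|b») («ab|cy») («aby|c»)).L1 + ((«a|b|c|y» + «a|b|cy» + «a|by|c» + «a|bc|y» + «ay|b|c» + «a|bcy» + «ay|bc») - («a|b|c|y» + «a|b|cy» + «a|by|c» + «a|bc|y» + «ay|b|c» + «ac|b|y» + «a|bcy» + «ay|bc» + «ac|by» + «acy|b») * («a|b|c|y» + «a|b|cy» + «a|by|c» + «a|bc|y» + «ay|b|c» + «ab|c|y» + «a|bcy» + «ay|bc» + «ab|cy» + «aby|c»)) * («acy|b» + «ac|by» + «ac|b|y») + ((«a|b|c|y» + «a|b|cy» + «a|by|c» + «ay|b|c» + «ac|b|y» + «ac|by» + «acy|b») - («a|b|c|y» + «a|b|cy» + «a|by|c» + «a|bc|y» + «ay|b|c» + «ac|b|y» + «a|bcy» + «ay|bc» + «ac|by» + «acy|b») * («a|b|c|y» + «a|b|cy» + «a|by|c» + «ay|b|c» + «ac|b|y» + «ab|c|y» + «ac|by» + «acy|b» + «ab|cy» + «aby|c»)) *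 («ay|bc» + «a|bc|y») + ((«a|b|c|y» + «a|b|cy» + «ay|b|c» + «ac|b|y» + «acy|b») - («a|b|c|y» + «a|b|cy» + «a|by|c» + «ay|b|c» + «ac|b|y» + «ab|c|y» + «ac|by» + «acy|b» + «ab|cy» + «aby|c») * («a|b|c|y» + «a|b|cy» + «a|bc|y» + «ay|b|c» + «ac|b|y» + «ay|bc» + «acy|b»)) * («ay|bc» + «a|bcy» + «a|bc|y») + ((«a|b|c|y» + «a|bc|y» + «ay|b|c» + «ay|bc») - («a|b|c|y» + «a|b|cy» + «a|bc|y» + «ay|b|c» + «ac|b|y» + «ay|bc» + «acy|b») * («a|b|c|y» + «a|by|c» + «a|bc|y» + «ay|b|c» + «ab|c|y» + «ay|bc» + «aby|c»)) * («acy|b» + «ac|by» + «ac|b|y») + («ab|cy» * «acy|b» * «ac|by» + «ab|cy» * «acy|b» * «a|bcy» + «ab|cy» * «acy|b» * «a|by|c» + «ab|cy» * «ac|by» * «ac|by» + «ab|cy» * «ac|by» * «ac|b|y» + «ab|cy» * «ac|by» * «a|bcy» + «ab|cy» * «ac|by» * «a|by|c» + «ab|cy» * «ac|b|y» * «a|bcy»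 + «ab|cy» * «ac|b|y» * «a|by|c» + «acy|b» * «ac|by» * «a|bcy» + «acy|b» * «ac|by» * «a|b|cy» + «acy|b» * «a|bcy» * «a|bcy» + «acy|b» * «a|bcy» * «a|by|c» + «acy|b» * «a|bcy» * «a|b|cy» + «acy|b» * «a|by|c» * «a|b|cy» + «ac|by» * «ac|by» * «a|bcy» + «ac|by» * «ac|by» * «a|b|cy» + «ac|by» * «ac|b|y» * «a|bcy» + «ac|by» * «ac|b|y» * «a|b|cy» + «ac|by» * «a|bcy» * «a|bcy» + «ac|by» * «a|bcy» * «a|by|c» + «ac|by» * «a|bcy» * «a|b|cy» + «ac|by» * «a|by|c» * «a|b|cy» + «ac|b|y» * «a|bcy» * «a|bcy» + «ac|b|y» * «a|bcy» * «a|by|c» + «ac|b|y» * «a|bcy» * «a|b|cy» + «ac|b|y» * «a|by|c» * «a|b|cy») := by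
  simp only [ofCells, L1, E3h, pol]; ring

/-- **Pendant-`b` move from Harris**: the two Harris inequalities for the pairs `(D[a|c], D[b|acy])`, `(D[b|ac], D[c|ay])` of `λ`, (L1) for
`λ`, and `r ∈ [0,1]` give (L1) along the whole pendant-`b` pencil. [folklore] -/
theorem L1_cells_pendant_b_nonneg_of_harris {«a|b|c|y» «a|b|cy» «a|by|c» «a|bc|y» «ay|b|c» «ac|b|y» «ab|c|y» «a|bcy» «ay|bc» «ac|by» «acy|b» «ab|cy» «aby|c» «abc|y» «abcy» r : ℝ}
    (hσ : «a|b|c|y» + «a|b|cy» + «a|by|c» + «a|bc|y» + «ay|b|c» + «ac|b|y» + «ab|c|y» + «a|bcy» + «ay|bc» + «ac|by» + «acy|b» + «ab|cy» + «aby|c» + «abc|y» + «abcy» = 1) (hr0 : 0 ≤ r) (hr1 : r ≤ 1)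
    (hH₁ : («a|b|c|y» + «a|b|cy» + «a|by|c» + «a|bc|y» + «ay|b|c» + «ab|c|y» + «a|bcy» + «ay|bc» + «ab|cy» + «aby|c») * («a|b|c|y» + «a|b|cy» + «ay|b|c» + «ac|b|y» + «acy|b») ≤ («a|b|c|y» + «a|b|cy» + «ay|b|c»))
    (hH₂ : («a|b|c|y» + «a|b|cy» + «a|by|c» + «ay|b|c» + «ac|b|y» + «ac|by» + «acy|b») * («a|b|c|y» + «a|by|c» + «a|bc|y» + «ay|b|c» + «ab|c|y» + «ay|bc» + «aby|c») ≤ («a|b|c|y» + «a|by|c» + «ay|b|c»))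
    (hL : 0 ≤ (ofCells («a|b|c|y») («a|b|cy») («a|by|c») («a|bc|y») («ay|b|c») («ac|b|y») («ab|c|y») («a|bcy») («ay|bc») («ac|by») («acy|b») («ab|cy») («aby|c»)).L1) :
    0 ≤ (ofCells ((1 - r) * («a|b|c|y» + «a|by|c» + «a|bc|y» + «ab|c|y») + r * «a|b|c|y») ((1 - r) * («a|b|cy» + «a|bcy» + «ab|cy») + r * «a|b|cy») (r * «a|by|c») (r * «a|bc|y») ((1 - r) * («ay|b|c» + «ay|bc» + «aby|c») + r * «ay|b|c») ((1 - r) * («ac|b|y» + «ac|by» + «abc|y») + r * «ac|b|y») (r * «ab|c|y») (r * «a|bcy») (r * «ay|bc») (r * «ac|by») ((1 - r) * («acy|b» + «abcy») + r * «acy|b») (r * «ab|cy») (r * «aby|c»)).L1 := by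
  rw [L1_cells_pendant_b_two_harris «a|b|c|y» «a|b|cy» «a|by|c» «a|bc|y» «ay|b|c» «ac|b|y» «ab|c|y» «a|bcy» «ay|bc» «ac|by» «acy|b» «ab|cy» «aby|c» «abc|y» «abcy» r hσ]
  have h1 : 0 ≤ 1 - r := by linarith
  have hH : 0 ≤ ((«a|b|c|y» + «a|b|cy» + «ay|b|c») - («a|b|c|y» + «a|b|cy» + «a|by|c» + «a|bc|y» + «ay|b|c» + «ab|c|y» + «a|bcy» + «ay|bc» + «ab|cy» + «aby|c») * («a|b|c|y» + «a|b|cy» + «ay|b|c» + «ac|b|y» + «acy|b»)) + ((«a|b|c|y» + «a|by|c» + «ay|b|c») - («a|b|c|y» + «a|b|cy» + «a|by|c» + «ay|b|c» + «ac|b|y» + «ac|by» + «acy|b») * («a|b|c|y» + «a|by|c» + «a|bc|y» + «ay|b|c» + «ab|c|y» + «ay|bc» + «aby|c»)) := by linarith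
  have e1 : 0 ≤ r * (1 - r) * (((«a|b|c|y» + «a|b|cy» + «ay|b|c») - («a|b|c|y» + «a|b|cy» + «a|by|c» + «a|bc|y» + «ay|b|c» + «ab|c|y» + «a|bcy» + «ay|bc» + «ab|cy» + «aby|c») * («a|b|c|y» + «a|b|cy» + «ay|b|c» + «ac|b|y» + «acy|b»)) + ((«a|b|c|y» + «a|by|c» + «ay|b|c») - («a|b|c|y» + «a|b|cy» + «a|by|c» + «ay|b|c» + «ac|b|y» + «ac|by» + «acy|b») * («a|b|c|y» + «a|by|c» + «a|bc|y» + «ay|b|c» + «ab|c|y» + «ay|bc» + «aby|c»))) := mul_nonneg (mul_nonneg hr0 h1) hH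
  have e2 : 0 ≤ r ^ 2 * (ofCells («a|b|c|y») («a|b|cy») («a|by|c») («a|bc|y») («ay|b|c») («ac|b|y») («ab|c|y») («a|bcy») («ay|bc») («ac|by») («acy|b») («ab|cy») («aby|c»)).L1 := mul_nonneg (pow_nonneg hr0 2) hL
  linarith

/-- **`(a,b)`-edge move, first piece, from Harris**: (L1) for `λ`, the four Harris inequalities and nonnegative cells give `pol(λ, glue_ab λ) ≥ 0`.
[folklore] -/
theorem pol_cells_edge_ab_nonneg {«a|b|c|y» «a|b|cy» «a|by|c» «a|bc|y» «ay|b|c» «ac|b|y» «ab|c|y» «a|bcy» «ay|bc» «ac|by» «acy|b» «ab|cy» «aby|c» : ℝ}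
    (h3 : 0 ≤ «ab|cy») (h5 : 0 ≤ «acy|b») (h6 : 0 ≤ «ac|by») (h7 : 0 ≤ «ac|b|y») (h8 : 0 ≤ «ay|bc») (h9 : 0 ≤ «a|bcy»)
    (h10 : 0 ≤ «a|bc|y») (h12 : 0 ≤ «a|by|c») (h13 : 0 ≤ «a|b|cy»)
    (hA : («a|b|c|y» + «a|b|cy» + «a|by|c» + «a|bc|y» + «ay|b|c» + «ac|b|y» + «a|bcy» + «ay|bc» + «ac|by» + «acy|b») * («a|b|c|y» + «a|b|cy» + «a|by|c» + «a|bc|y» + «ay|b|c» + «ab|c|y» + «a|bcy» + «ay|bc» + «ab|cy» + «aby|c») ≤ («a|b|c|y» + «a|b|cy» + «a|by|c» + «a|bc|y» + «ay|b|c» + «a|bcy» + «ay|bc»)) (hB : («a|b|c|y» + «a|b|cy» + «a|by|c» + «a|bc|y» + «ay|b|c» + «ac|b|y» + «a|bcy» + «ay|bc» + «ac|by» + «acy|b») * («a|b|c|y» + «a|b|cy» + «a|by|c» + «ay|b|c» + «ac|b|y» + «ab|c|y» + «ac|by» + «acy|b» + «ab|cy» + «aby|c») ≤ («a|b|c|y»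 + «a|b|cy» + «a|by|c» + «ay|b|c» + «ac|b|y» + «ac|by» + «acy|b»))
    (hC : («a|b|c|y» + «a|b|cy» + «a|by|c» + «ay|b|c» + «ac|b|y» + «ab|c|y» + «ac|by» + «acy|b» + «ab|cy» + «aby|c») * («a|b|c|y» + «a|b|cy» + «a|bc|y» + «ay|b|c» + «ac|b|y» + «ay|bc» + «acy|b») ≤ («a|b|c|y» + «a|b|cy» + «ay|b|c» + «ac|b|y» + «acy|b»)) (hD : («a|b|c|y» + «a|b|cy» + «a|bc|y» + «ay|b|c» + «ac|b|y» + «ay|bc» + «acy|b») * («a|b|c|y» + «a|by|c» + «a|bc|y» + «ay|b|c» + «ab|c|y» + «ay|bc» + «aby|c») ≤ («a|b|c|y» + «a|bc|y» + «ay|b|c» + «ay|bc»))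
    (hL : 0 ≤ (ofCells («a|b|c|y») («a|b|cy») («a|by|c») («a|bc|y») («ay|b|c») («ac|b|y») («ab|c|y») («a|bcy») («ay|bc») («ac|by») («acy|b») («ab|cy») («aby|c»)).L1) :
    0 ≤ pol (ofCells («a|b|c|y») («a|b|cy») («a|by|c») («a|bc|y») («ay|b|c») («ac|b|y») («ab|c|y») («a|bcy») («ay|bc») («ac|by») («acy|b») («ab|cy») («aby|c»)) (ofCells 0 0 0 0 0 0 («a|b|c|y» + «ab|c|y») 0 0 0 0 («a|b|cy» + «ab|cy») («a|by|c» + «ay|b|c» + «aby|c»)) := by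
  rw [pol_cells_edge_ab]
  have eA : 0 ≤ ((«a|b|c|y» + «a|b|cy» + «a|by|c» + «a|bc|y» + «ay|b|c» + «a|bcy» + «ay|bc») - («a|b|c|y» + «a|b|cy» + «a|by|c» + «a|bc|y» + «ay|b|c» + «ac|b|y» + «a|bcy» + «ay|bc» + «ac|by» + «acy|b») * («a|b|c|y» + «a|b|cy» + «a|by|c» + «a|bc|y» + «ay|b|c» + «ab|c|y» + «a|bcy» + «ay|bc» + «ab|cy» + «aby|c»)) * («acy|b» + «ac|by» + «ac|b|y») := mul_nonneg (by linarith) (by linarith)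
  have eB : 0 ≤ ((«a|b|c|y» + «a|b|cy» + «a|by|c» + «ay|b|c» + «ac|b|y» + «ac|by» + «acy|b») - («a|b|c|y» + «a|b|cy» + «a|by|c» + «a|bc|y» + «ay|b|c» + «ac|b|y» + «a|bcy» + «ay|bc» + «ac|by» + «acy|b») * («a|b|c|y» + «a|b|cy» + «a|by|c» + «ay|b|c» + «ac|b|y» + «ab|c|y» + «ac|by» + «acy|b» + «ab|cy» + «aby|c»)) * («ay|bc» + «a|bc|y») := mul_nonneg (by linarith) (by linarith)
  have eC : 0 ≤ ((«a|b|c|y» + «a|b|cy» + «ay|b|c» + «ac|b|y» + «acy|b») - («a|b|c|y» + «a|b|cy» + «a|by|c» + «ay|b|c» + «ac|b|y» + «ab|c|y» + «ac|by» + «acy|b» + «ab|cy» + «aby|c») * («a|b|c|y» + «a|b|cy» + «a|bc|y» + «ay|b|c» + «ac|b|y» + «ay|bc» + «acy|b»)) * («ay|bc» + «a|bcy» + «a|bc|y») := mul_nonneg (by linarith) (by linarith)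
  have eD : 0 ≤ ((«a|b|c|y» + «a|bc|y» + «ay|b|c» + «ay|bc») - («a|b|c|y» + «a|b|cy» + «a|bc|y» + «ay|b|c» + «ac|b|y» + «ay|bc» + «acy|b») * («a|b|c|y» + «a|by|c» + «a|bc|y» + «ay|b|c» + «ab|c|y» + «ay|bc» + «aby|c»)) * («acy|b» + «ac|by» + «ac|b|y») := mul_nonneg (by linarith) (by linarith)
  have eM : 0 ≤ «ab|cy» * «acy|b» * «ac|by» + «ab|cy» * «acy|b» * «a|bcy» + «ab|cy» * «acy|b» * «a|by|c» + «ab|cy» * «ac|by» * «ac|by» + «ab|cy» * «ac|by» * «ac|b|y» + «ab|cy» * «ac|by» * «a|bcy» + «ab|cy» * «ac|by» * «a|by|c» + «ab|cy» * «ac|b|y» * «a|bcy» + «ab|cy» * «ac|b|y» * «a|by|c» + «acy|b» * «ac|by» * «a|bcy» + «acy|b» * «ac|by» * «a|b|cy» + «acy|b» * «a|bcy» * «a|bcy» + «acy|b» * «a|bcy» * «a|by|c» + «acy|b» * «a|bcy» * «a|b|cy» + «acy|b» * «a|by|c» * «a|b|cy» + «ac|by» * «ac|by» * «a|bcy» +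 «ac|by» * «ac|by» * «a|b|cy» + «ac|by» * «ac|b|y» * «a|bcy» + «ac|by» * «ac|b|y» * «a|b|cy» + «ac|by» * «a|bcy» * «a|bcy» + «ac|by» * «a|bcy» * «a|by|c» + «ac|by» * «a|bcy» * «a|b|cy» + «ac|by» * «a|by|c» * «a|b|cy» + «ac|b|y» * «a|bcy» * «a|bcy» + «ac|b|y» * «a|bcy» * «a|by|c» + «ac|b|y» * «a|bcy» * «a|b|cy» + «ac|b|y» * «a|by|c» * «a|b|cy» := by positivity
  have eL : 0 ≤ 2 * (ofCells («a|b|c|y») («a|b|cy») («a|by|c») («a|bc|y») («ay|b|c») («ac|b|y») («ab|c|y») («a|bcy») («ay|bc») («ac|by») («acy|b») («ab|cy») («aby|c»)).L1 := by linarith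
  linarith

end HybMasses

end Summit.CriticalPhenomena.PercolationContinuityZ3.Theorems
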